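import Summits.Ventures.HSemireg.WedgeMixedBox
import Summits.Ventures.HSemireg.WedgeWeilSpan
import Summits.Ventures.HSemireg.WedgeHankelDual

/-!
# Venture HSemireg — THE KÜNNETH KERNEL LAW: the kernel of `θ ↦ θ ∧ (f₁ ∧ f₂)` on a product is generated by the kernels
# of its factors — `Kr(D₁ ⊔ D₂, f₁f₂, k) = Σ_{a+b=k} ( Kr(D₁,f₁,a) ∧ Hom(D₂,b) + Hom(D₁,a) ∧ Kr(D₂,f₂,b) )`, uniform in everything

HONEST FRAMING. Part of the Lean index of the computation cell `pub-hsemireg` (seat p10 gen 13, Sunday typer «UNIFORM-IN-n»).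
Finite-dimensional EXTERIOR ALGEBRA over a field ONLY: no variety, no cohomology theory, no sheaf, no Ext group and no
semiregularity map is constructed here; nothing here says that HC / HC_CM / HC_AV holds; no Literature fact is declared or
used.  Custodian versions cited: theory/FORMULA-N.md PART A §2.3 THEOREM K («Künneth multiplicativity: rank polynomials
MULTIPLY»), PART B §A.3 / §N.3 / §N.7 (a) (th-7's sign-free wedge model and its block form), th-7 Cor. A.4 (the degree-2 kernel
of a box of two point objects is `H¹(T_X) ⊗ 1 ⊕ 1 ⊗ H¹(T_{X′})`); STRUCTURE.md v1.0-SIGNED 9b196a05977dd067 §1.1 rows C4 / C10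
(name of the kernel).  The dictionary (`HT^k(X × X′) ↔ ⋀^k` on the disjoint union of the two generator blocks; contraction against
`ch(E ⊠ E′)` ↔ `θ ↦ θ ∧ (f₁ ∧ f₂)`, sign-blind) is QUOTED from those files, never asserted.

WHAT IS IN THE TREE.  THEOREM K_lin (`WedgeKunneth.finrank_V_mul`, th-7): for disjoint generator blocks `D₁, D₂` and HOMOGENEOUS
classes `f₁ ∈ Hom(D₁,d₁)`, `f₂ ∈ Hom(D₂,d₂)` the RANKS multiply — `dim V_{D₁⊔D₂}(f₁f₂, k) = Σ_{a+b=k} r_a(f₁)·r_b(f₂)` — and its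
iteration over any finite splitting (`WedgeMixedBox.rankPoly_prodR`, gen 6).  That names the DIMENSION of every box kernel by
rank–nullity, but not the kernel itself.  THIS FILE names the KERNEL, with no hypothesis on the classes beyond homogeneity:
* §1 the FACTOR KERNEL SPACES `Kr(D, f, a) := {θ ∈ Hom(D,a) : θ ∧ f = 0}` (`Kr`) with the per-degree rank–nullity
  **`finrank_Kr_add_finrank_V`: `dim Kr(D,f,a) + r_a(f) = C(|D|, a)`**; graded commutation of homogeneous classes (`mul_comm_Hom`).
* §2 the obvious half: **`Kr(D₁,f₁,a) ∧ Hom(D₂,b)` and `Hom(D₁,a) ∧ Kr(D₂,f₂,b)` lie in `Kr(D₁ ⊔ D₂, f₁f₂, a+b)`** (`Kr_mul_Hom_le`,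
  `Hom_mul_Kr_le`); their sum over `a + b = k` is the KÜNNETH KERNEL SUM `krSum` (`krSum_le_Kr`).
* §3 **THE KÜNNETH KERNEL LAW `Kr_union_eq_krSum`: `Kr(D₁ ⊔ D₂, f₁f₂, k) = Σ_{a+b=k} ( Kr(D₁,f₁,a) ∧ Hom(D₂,b) + Hom(D₁,a) ∧
  Kr(D₂,f₂,b) )`** for EVERY field, every disjoint blocks, every homogeneous `f₁, f₂` and every `k` — the kernel of a box is
  GENERATED BY THE KERNELS OF ITS FACTORS («no new kernel classes on a product»).  Mechanism: bases of `Hom(D_i, a)` adapted to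
  `Kr(D_i, f_i, a) ⊕ C_i^a`; th-7's `linearIndependent_mul` twice — once for the products of the adapted bases (a basis of
  `Hom(D₁ ⊔ D₂, k)` in which to expand `θ`), once for the products `(c ∧ f₁) ∧ (c′ ∧ f₂)` of the IMAGES of the complement vectors,
  which are independent because `θ ↦ θ ∧ f_i` is injective on `C_i`; so `θ ∧ f₁f₂ = 0` kills every complement–complement
  coefficient and what is left lies in the Künneth kernel sum.  Wedge form **`ker_wedge_mul`: `ker(θ ↦ θ ∧ f₁f₂ ∣ ⋀^k) = krSum_k`**
  when the two blocks cover the generators.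
The sequel `WedgeKunnethKernelLow` does the bookkeeping (kernel co-polynomial law), the low degrees (a box of NON-DEGENERATE factors
has degree-2 kernel `Kr(D₁,f₁,2) ⊕ Kr(D₂,f₂,2)` — th-7 Cor. A.4's shape for arbitrary classes) and the iteration over any finite
splitting.  NOT typed here: the specialisation to Hankel classes / boxes of `K[Θ_i]`-classes (there `Kr(block_i, v_i, ·)` is gen
11's Siegel ideal plus the Hankel excess); anything Ext-side.  Class side only.
Namespace `Summit.Ventures.HSemireg.Wedge.KunnethKernel` (new); new names only.
-/

open Module

namespace Summit.Ventures.HSemireg.Wedge.KunnethKernel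

open Summit.Ventures.HSemireg.Wedge Summit.Ventures.HSemireg.Wedge.Kunneth Summit.Ventures.HSemireg.Wedge.MixedBox

variable (K : Type*) [Field K] {I : Type*} [LinearOrder I] [Fintype I]

/-! ## §1. Factor kernel spaces `Kr(D, f, a)` and the per-degree rank–nullity -/

/-- **the FACTOR KERNEL SPACE `Kr(D, f, a) := {θ ∈ Hom(D, a) : θ ∧ f = 0}`**: the degree-`a` forms on the block `D` killed by
(right multiplication with) the class `f`. -/
noncomputable def Kr (D : Finset I) (f : HT K I) (a : ℕ) : Submodule K (HT K I) :=
  Hom K I D a ⊓ LinearMap.ker (LinearMap.mulRight K f)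

variable {K} in
/-- membership in a factor kernel space. -/
lemma mem_Kr {D : Finset I} {f : HT K I} {a : ℕ} {θ : HT K I} :
    θ ∈ Kr K D f a ↔ θ ∈ Hom K I D a ∧ θ * f = 0 := by
  rw [Kr, Submodule.mem_inf, LinearMap.mem_ker, LinearMap.mulRight_apply]

/-- `Kr(D, f, a) ≤ Hom(D, a)`. -/
lemma Kr_le_Hom (D : Finset I) (f : HT K I) (a : ℕ) : Kr K D f a ≤ Hom K I D a := inf_le_left

/-- th-7's factor rank space is the image of `Hom(D, a)` under `θ ↦ θ ∧ f`. -/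
lemma V_eq_map (D : Finset I) (f : HT K I) (a : ℕ) :
    V K I D f a = (Hom K I D a).map (LinearMap.mulRight K f) := by
  rw [V, Hom, Submodule.map_span, Set.image_image]
  rfl

/-- `dim Hom(D, d) = C(|D|, d)` (the degree-`d` monomials on `D` are a basis; any generator type). -/
private lemma finrank_Hom_card (D : Finset I) (d : ℕ) : finrank K ↥(Hom K I D d) = D.card.choose d := by
  classical
  rw [Weil.Hom_eq_Sp, Weil.finrank_Sp]
  have h : Finset.univ.filter (fun s : Finset I => s ⊆ D ∧ s.card = d) = D.powersetCard d := by
    ext s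
    simp [Finset.mem_powersetCard]
  rw [h, Finset.card_powersetCard]

/-- **PER-DEGREE RANK–NULLITY ON ONE BLOCK: `dim Kr(D, f, a) + r_a(f) = C(|D|, a)`** (`r_a(f) = dim V_D(f, a)`, th-7's factor rank). -/
theorem finrank_Kr_add_finrank_V (D : Finset I) (f : HT K I) (a : ℕ) :
    finrank K (Kr K D f a) + finrank K (V K I D f a) = D.card.choose a := by
  let g : Hom K I D a →ₗ[K] HT K I := (LinearMap.mulRight K f) ∘ₗ (Hom K I D a).subtype
  have hrange : LinearMap.range g = V K I D f a := by
    rw [LinearMap.range_comp, Submodule.range_subtype, V_eq_map]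
  have hker : LinearMap.ker g = (Kr K D f a).comap (Hom K I D a).subtype := by
    ext θ
    rw [LinearMap.mem_ker, Submodule.mem_comap, Submodule.subtype_apply, mem_Kr, LinearMap.comp_apply,
      Submodule.subtype_apply, LinearMap.mulRight_apply]
    exact ⟨fun h => ⟨θ.2, h⟩, fun h => h.2⟩
  have h := LinearMap.finrank_range_add_finrank_ker g
  rw [hrange, hker, (Submodule.comapSubtypeEquivOfLe (Kr_le_Hom K D f a)).finrank_eq, finrank_Hom_card] at h
  omega

/-- `r_a(f) ≤ C(|D|, a)`. -/
lemma finrank_V_le (D : Finset I) (f : HT K I) (a : ℕ) : finrank K (V K I D f a) ≤ D.card.choose a := by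
  have := finrank_Kr_add_finrank_V K D f a; omega

/-- GRADED COMMUTATION of homogeneous classes: `f ∧ g = (−1)^{d·e} · g ∧ f` for `f ∈ Hom(D₁, d)`, `g ∈ Hom(D₂, e)` (any blocks). -/
lemma mul_comm_Hom {D₁ D₂ : Finset I} {d e : ℕ} {f g : HT K I} (hf : f ∈ Hom K I D₁ d) (hg : g ∈ Hom K I D₂ e) :
    f * g = ((-1 : K) ^ (d * e)) • (g * f) := by
  induction hf using Submodule.span_induction with
  | mem x hx =>
    obtain ⟨t, ht, rfl⟩ := hx
    rw [B_mul_comm_of_mem_Hom K hg, ht.2]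
  | zero => rw [zero_mul, mul_zero, smul_zero]
  | add x y _ _ hx hy => rw [add_mul, mul_add, hx, hy, smul_add]
  | smul c x _ hx => rw [smul_mul_assoc, mul_smul_comm, hx, smul_comm]

/-- `(x ∧ y) ∧ (f₁ ∧ f₂) = (−1)^{b·d₁} · (x ∧ f₁) ∧ (y ∧ f₂)` for `y ∈ Hom(D₂, b)`, `f₁ ∈ Hom(D₁, d₁)`. -/
lemma mul_mul_mul_eq {D₁ D₂ : Finset I} {d₁ b : ℕ} {f₁ y : HT K I} (hf₁ : f₁ ∈ Hom K I D₁ d₁) (hy : y ∈ Hom K I D₂ b)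
    (x f₂ : HT K I) : (x * y) * (f₁ * f₂) = ((-1 : K) ^ (b * d₁)) • ((x * f₁) * (y * f₂)) := by
  rw [mul_assoc, ← mul_assoc y, mul_comm_Hom K hy hf₁]
  simp only [smul_mul_assoc, mul_smul_comm, mul_assoc]

/-! ## §2. The Künneth kernel sum and the obvious inclusion -/

/-- **`Kr(D₁, f₁, a) ∧ Hom(D₂, b) ≤ Kr(D₁ ⊔ D₂, f₁f₂, a + b)`**: `(x ∧ y) ∧ f₁f₂ = ± (x ∧ f₁) ∧ (y ∧ f₂) = 0`. -/
theorem Kr_mul_Hom_le {D₁ D₂ : Finset I} (hD : Disjoint D₁ D₂) {d₁ : ℕ} {f₁ : HT K I} (hf₁ : f₁ ∈ Hom K I D₁ d₁)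
    (f₂ : HT K I) (a b : ℕ) : Kr K D₁ f₁ a * Hom K I D₂ b ≤ Kr K (D₁ ∪ D₂) (f₁ * f₂) (a + b) := by
  rw [Submodule.mul_le]
  intro x hx y hy
  rw [mem_Kr] at hx ⊢
  refine ⟨Kunneth.mul_mem_Hom K hD hx.1 hy, ?_⟩
  rw [mul_mul_mul_eq K hf₁ hy, hx.2, zero_mul, smul_zero]

/-- **`Hom(D₁, a) ∧ Kr(D₂, f₂, b) ≤ Kr(D₁ ⊔ D₂, f₁f₂, a + b)`**. -/
theorem Hom_mul_Kr_le {D₁ D₂ : Finset I} (hD : Disjoint D₁ D₂) {d₁ : ℕ} {f₁ : HT K I} (hf₁ : f₁ ∈ Hom K I D₁ d₁)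
    (f₂ : HT K I) (a b : ℕ) : Hom K I D₁ a * Kr K D₂ f₂ b ≤ Kr K (D₁ ∪ D₂) (f₁ * f₂) (a + b) := by
  rw [Submodule.mul_le]
  intro x hx y hy
  rw [mem_Kr] at hy ⊢
  refine ⟨Kunneth.mul_mem_Hom K hD hx hy.1, ?_⟩
  rw [mul_mul_mul_eq K hf₁ hy.1, hy.2, mul_zero, smul_zero]

/-- **THE KÜNNETH KERNEL SUM `krSum_k(f₁, f₂) := Σ_{a ≤ k} ( Kr(D₁,f₁,a) ∧ Hom(D₂,k−a) + Hom(D₁,a) ∧ Kr(D₂,f₂,k−a) )`**: the part of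
the product kernel forced by the kernels of the factors. -/
noncomputable def krSum (D₁ D₂ : Finset I) (f₁ f₂ : HT K I) (k : ℕ) : Submodule K (HT K I) :=
  ⨆ a ∈ Finset.range (k + 1), (Kr K D₁ f₁ a * Hom K I D₂ (k - a) ⊔ Hom K I D₁ a * Kr K D₂ f₂ (k - a))

/-- the obvious inclusion: **`krSum_k(f₁, f₂) ≤ Kr(D₁ ⊔ D₂, f₁f₂, k)`**. -/
theorem krSum_le_Kr {D₁ D₂ : Finset I} (hD : Disjoint D₁ D₂) {d₁ : ℕ} {f₁ : HT K I} (hf₁ : f₁ ∈ Hom K I D₁ d₁)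
    (f₂ : HT K I) (k : ℕ) : krSum K D₁ D₂ f₁ f₂ k ≤ Kr K (D₁ ∪ D₂) (f₁ * f₂) k := by
  refine iSup₂_le fun a ha => ?_
  have hak : a + (k - a) = k := by rw [Finset.mem_range] at ha; omega
  exact sup_le ((Kr_mul_Hom_le K hD hf₁ f₂ a (k - a)).trans (by rw [hak]))
    ((Hom_mul_Kr_le K hD hf₁ f₂ a (k - a)).trans (by rw [hak]))

/-! ## §3. THE KÜNNETH KERNEL LAW -/

/-! ### Adapted bases (generic bookkeeping) -/

/-- a complement of `P` inside `Q ≥ P`. -/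
lemma exists_compl_le {W : Type*} [AddCommGroup W] [Module K W] {P Q : Submodule K W} (h : P ≤ Q) :
    ∃ C : Submodule K W, C ≤ Q ∧ P ⊓ C = ⊥ ∧ P ⊔ C = Q := by
  obtain ⟨C', hC'⟩ := (P.comap Q.subtype).exists_isCompl
  refine ⟨C'.map Q.subtype, Submodule.map_subtype_le Q C', ?_, ?_⟩
  · rw [eq_bot_iff]
    intro x hx
    obtain ⟨hxP, hxC⟩ := Submodule.mem_inf.mp hx
    obtain ⟨y, hyC, rfl⟩ := Submodule.mem_map.mp hxC
    have hy : y ∈ P.comap Q.subtype ⊓ C' := Submodule.mem_inf.mpr ⟨hxP, hyC⟩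
    rw [hC'.inf_eq_bot, Submodule.mem_bot] at hy
    rw [Submodule.mem_bot, hy, map_zero]
  · refine le_antisymm (sup_le h (Submodule.map_subtype_le Q C')) fun x hx => ?_
    have htop : (⟨x, hx⟩ : Q) ∈ P.comap Q.subtype ⊔ C' := by rw [hC'.sup_eq_top]; exact Submodule.mem_top
    obtain ⟨y, hy, z, hz, hyz⟩ := Submodule.mem_sup.mp htop
    have hx' : x = (y : W) + (z : W) := by rw [← Submodule.coe_add, hyz]
    rw [hx']
    exact Submodule.add_mem_sup hy (Submodule.mem_map_of_mem hz)

/-- the vectors of a (chosen) basis of a subspace, as elements of the algebra. -/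
noncomputable def vecs (M : Submodule K (HT K I)) (i : Fin (finrank K M)) : HT K I := (Module.finBasis K M i : HT K I)

/-- the basis vectors lie in the subspace. -/
lemma vecs_mem (M : Submodule K (HT K I)) (i : Fin (finrank K M)) : vecs K M i ∈ M := (Module.finBasis K M i).2

/-- the basis vectors are linearly independent in the algebra. -/
lemma linearIndependent_vecs (M : Submodule K (HT K I)) : LinearIndependent K (vecs K M) :=
  (Module.finBasis K M).linearIndependent.map' M.subtype (Submodule.ker_subtype M)

/-- the basis vectors span the subspace. -/
lemma span_vecs (M : Submodule K (HT K I)) : Submodule.span K (Set.range (vecs K M)) = M := by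
  have h : vecs K M = M.subtype ∘ (Module.finBasis K M) := rfl
  rw [h, Set.range_comp, Submodule.span_image, (Module.finBasis K M).span_eq, Submodule.map_top, Submodule.range_subtype]

/-- the ADAPTED FAMILY of a pair of subspaces: first the basis vectors of `P`, then those of `C`. -/
noncomputable def pairVecs (P C : Submodule K (HT K I)) : Fin (finrank K P) ⊕ Fin (finrank K C) → HT K I :=
  Sum.elim (vecs K P) (vecs K C)

/-- left summands of the adapted family are the basis vectors of `P`. -/
@[simp] lemma pairVecs_inl (P C : Submodule K (HT K I)) (i : Fin (finrank K P)) :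
    pairVecs K P C (Sum.inl i) = vecs K P i := rfl

/-- right summands of the adapted family are the basis vectors of `C`. -/
@[simp] lemma pairVecs_inr (P C : Submodule K (HT K I)) (j : Fin (finrank K C)) :
    pairVecs K P C (Sum.inr j) = vecs K C j := rfl

/-- the adapted family is linearly independent when `P ⊓ C = 0`. -/
lemma linearIndependent_pairVecs {P C : Submodule K (HT K I)} (h : P ⊓ C = ⊥) : LinearIndependent K (pairVecs K P C) := by
  refine (linearIndependent_vecs K P).sum_type (linearIndependent_vecs K C) ?_
  rw [span_vecs, span_vecs, disjoint_iff, h]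

/-- the adapted family spans `P ⊔ C`. -/
lemma span_pairVecs (P C : Submodule K (HT K I)) : Submodule.span K (Set.range (pairVecs K P C)) = P ⊔ C := by
  rw [pairVecs, Set.Sum.elim_range, Submodule.span_union, span_vecs, span_vecs]

/-- every vector of the adapted family lies in `P ⊔ C`. -/
lemma pairVecs_mem (P C : Submodule K (HT K I)) (x : Fin (finrank K P) ⊕ Fin (finrank K C)) :
    pairVecs K P C x ∈ P ⊔ C := by
  rcases x with i | j
  · exact Submodule.mem_sup_left (vecs_mem K P i)
  · exact Submodule.mem_sup_right (vecs_mem K C j)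

/-- KÜNNETH SPLITTING, inclusion form: `Hom(D₁ ∪ D₂, k) ≤ Σ_{a ≤ k} Hom(D₁, a) ∧ Hom(D₂, k − a)` (a degree-`k` monomial on
`D₁ ∪ D₂` is, up to a unit, the product of its `D₁`-part and its part outside `D₁`; no disjointness needed). -/
private theorem Hom_union_le_iSup_mul (D₁ D₂ : Finset I) (k : ℕ) :
    Hom K I (D₁ ∪ D₂) k ≤ ⨆ a ∈ Finset.range (k + 1), Hom K I D₁ a * Hom K I D₂ (k - a) := by
  classical
  rw [Hom, Submodule.span_le]
  rintro _ ⟨t, ⟨ht, hk⟩, rfl⟩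
  have hdisj : Disjoint (t ∩ D₁) (t \ D₁) := by
    rw [Finset.disjoint_left]; intro x hx hx'; exact (Finset.mem_sdiff.mp hx').2 (Finset.mem_inter.mp hx).2
  have htu : t ∩ D₁ ∪ t \ D₁ = t := by rw [Finset.union_comm, Finset.sdiff_union_inter]
  have h₂ : t \ D₁ ⊆ D₂ := fun x hx => by
    rw [Finset.mem_sdiff] at hx; exact (Finset.mem_union.mp (ht hx.1)).resolve_left hx.2
  have hcard : (t \ D₁).card = k - (t ∩ D₁).card := by
    have := Finset.card_union_of_disjoint hdisj; rw [htu] at this; omega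
  have ha : (t ∩ D₁).card < k + 1 := by
    have := Finset.card_le_card (Finset.inter_subset_left : t ∩ D₁ ⊆ t); omega
  have hB : B K I t = (u K (t ∩ D₁) (t \ D₁))⁻¹ • (B K I (t ∩ D₁) * B K I (t \ D₁)) := by
    rw [B_mul_B, smul_smul, inv_mul_cancel₀ ((u_ne_zero_iff K).mpr hdisj), one_smul, htu]
  show B K I t ∈ _
  rw [hB]
  exact Submodule.smul_mem _ _ (Submodule.mem_iSup_of_mem (t ∩ D₁).card
    (Submodule.mem_iSup_of_mem (Finset.mem_range.mpr ha) (Submodule.mul_mem_mul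
      (B_mem_Hom K Finset.inter_subset_right rfl) (B_mem_Hom K h₂ hcard))))

/-! ### The law -/

/-- **THE KÜNNETH KERNEL LAW (hard half): `Kr(D₁ ⊔ D₂, f₁f₂, k) ≤ krSum_k(f₁, f₂)`** for disjoint blocks and homogeneous
`f₁ ∈ Hom(D₁, d₁)`, `f₂ ∈ Hom(D₂, d₂)` — every field, every `k`.  Expand `θ` in the products of bases of `Hom(D₁, a)`,
`Hom(D₂, k − a)` adapted to `Kr ⊕ C`; `θ ∧ f₁f₂` is then a combination of the products `(c ∧ f₁) ∧ (c′ ∧ f₂)` of images of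
complement vectors, which are linearly independent (th-7's `linearIndependent_mul`, the maps `θ ↦ θ ∧ f_i` being injective on
the complements); so all complement–complement coefficients vanish. -/
theorem Kr_union_le_krSum {D₁ D₂ : Finset I} (hD : Disjoint D₁ D₂) {d₁ d₂ : ℕ} {f₁ f₂ : HT K I}
    (hf₁ : f₁ ∈ Hom K I D₁ d₁) (hf₂ : f₂ ∈ Hom K I D₂ d₂) (k : ℕ) :
    Kr K (D₁ ∪ D₂) (f₁ * f₂) k ≤ krSum K D₁ D₂ f₁ f₂ k := by
  classical
  -- complements of the factor kernels inside the factor pieces, degree by degree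
  have e₁ : ∀ a : ℕ, ∃ C : Submodule K (HT K I),
      C ≤ Hom K I D₁ a ∧ Kr K D₁ f₁ a ⊓ C = ⊥ ∧ Kr K D₁ f₁ a ⊔ C = Hom K I D₁ a :=
    fun a => exists_compl_le K (Kr_le_Hom K D₁ f₁ a)
  have e₂ : ∀ b : ℕ, ∃ C : Submodule K (HT K I),
      C ≤ Hom K I D₂ b ∧ Kr K D₂ f₂ b ⊓ C = ⊥ ∧ Kr K D₂ f₂ b ⊔ C = Hom K I D₂ b :=
    fun b => exists_compl_le K (Kr_le_Hom K D₂ f₂ b)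
  choose C₁ hC₁le hC₁inf hC₁sup using e₁
  choose C₂ hC₂le hC₂inf hC₂sup using e₂
  -- the adapted families, indexed by `i : Fin (k+1)` ↔ bidegree `(i, k − i)`
  let v : (i : Fin (k + 1)) → Fin (finrank K (Kr K D₁ f₁ i)) ⊕ Fin (finrank K (C₁ i)) → HT K I :=
    fun i => pairVecs K (Kr K D₁ f₁ i) (C₁ i)
  let w : (i : Fin (k + 1)) → Fin (finrank K (Kr K D₂ f₂ (k - i))) ⊕ Fin (finrank K (C₂ (k - i))) → HT K I :=
    fun i => pairVecs K (Kr K D₂ f₂ (k - i)) (C₂ (k - i))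
  have hv : ∀ (i : Fin (k + 1)) α, v i α ∈ Hom K I D₁ (i : ℕ) := fun i α => by
    rw [← hC₁sup]; exact pairVecs_mem K _ _ α
  have hw : ∀ (i : Fin (k + 1)) β, w i β ∈ Hom K I D₂ (k - (i : ℕ)) := fun i β => by
    rw [← hC₂sup]; exact pairVecs_mem K _ _ β
  -- the image families of the complement vectors
  let v' : (i : Fin (k + 1)) → Fin (finrank K (C₁ i)) → HT K I := fun i β => vecs K (C₁ i) β * f₁
  let w' : (i : Fin (k + 1)) → Fin (finrank K (C₂ (k - i))) → HT K I := fun i γ => vecs K (C₂ (k - i)) γ * f₂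
  have hv' : ∀ (i : Fin (k + 1)) β, v' i β ∈ Hom K I D₁ ((i : ℕ) + d₁) := fun i β =>
    Wedge.mul_mem_Hom K (hC₁le i (vecs_mem K _ β)) hf₁
  have hw' : ∀ (i : Fin (k + 1)) γ, w' i γ ∈ Hom K I D₂ ((k - (i : ℕ)) + d₂) := fun i γ =>
    Wedge.mul_mem_Hom K (hC₂le (k - i) (vecs_mem K _ γ)) hf₂
  have hv'li : ∀ i, LinearIndependent K (v' i) := fun i => by
    refine (linearIndependent_vecs K (C₁ i)).map (f := LinearMap.mulRight K f₁) ?_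
    rw [span_vecs, Submodule.disjoint_def]
    intro x hxC hxker
    have hx : x ∈ Kr K D₁ f₁ i ⊓ C₁ i := Submodule.mem_inf.mpr ⟨Submodule.mem_inf.mpr ⟨hC₁le i hxC, hxker⟩, hxC⟩
    rwa [hC₁inf, Submodule.mem_bot] at hx
  have hw'li : ∀ i, LinearIndependent K (w' i) := fun i => by
    refine (linearIndependent_vecs K (C₂ (k - i))).map (f := LinearMap.mulRight K f₂) ?_
    rw [span_vecs, Submodule.disjoint_def]
    intro x hxC hxker
    have hx : x ∈ Kr K D₂ f₂ (k - i) ⊓ C₂ (k - i) :=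
      Submodule.mem_inf.mpr ⟨Submodule.mem_inf.mpr ⟨hC₂le (k - i) hxC, hxker⟩, hxC⟩
    rwa [hC₂inf, Submodule.mem_bot] at hx
  have hQli := linearIndependent_mul K hD (m := k + 1) (fun i => (i : ℕ) + d₁) (fun i => k - (i : ℕ) + d₂)
    (fun i j h => Fin.ext (by simpa using h)) v' w' hv' hw' hv'li hw'li
  -- the products of the adapted families span `Hom(D₁ ∪ D₂, k)`
  let P : (Σ i : Fin (k + 1), (Fin (finrank K (Kr K D₁ f₁ i)) ⊕ Fin (finrank K (C₁ i))) ×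
      (Fin (finrank K (Kr K D₂ f₂ (k - i))) ⊕ Fin (finrank K (C₂ (k - i))))) → HT K I :=
    fun x => v x.1 x.2.1 * w x.1 x.2.2
  have hHom_le : Hom K I (D₁ ∪ D₂) k ≤ Submodule.span K (Set.range P) := by
    refine (Hom_union_le_iSup_mul K D₁ D₂ k).trans (iSup₂_le fun a ha => ?_)
    have ha' : a < k + 1 := Finset.mem_range.mp ha
    let i : Fin (k + 1) := ⟨a, ha'⟩
    have h1 : Hom K I D₁ a = Submodule.span K (Set.range (v i)) := by rw [span_pairVecs, hC₁sup]
    have h2 : Hom K I D₂ (k - a) = Submodule.span K (Set.range (w i)) := by rw [span_pairVecs, hC₂sup]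
    rw [h1, h2, Submodule.span_mul_span, Submodule.span_le]
    rintro _ ⟨_, ⟨α, rfl⟩, _, ⟨β, rfl⟩, rfl⟩
    exact Submodule.subset_span ⟨⟨i, (α, β)⟩, rfl⟩
  -- expand a kernel element
  intro θ hθ
  obtain ⟨hθHom, hθf⟩ := mem_Kr.mp hθ
  obtain ⟨c, hc⟩ := (Submodule.mem_span_range_iff_exists_fun K).mp (hHom_le hθHom)
  -- the kernel basis vectors are killed
  have hvK : ∀ (i : Fin (k + 1)) (α : Fin (finrank K (Kr K D₁ f₁ i))), v i (Sum.inl α) * f₁ = 0 :=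
    fun i α => (mem_Kr.mp (vecs_mem K (Kr K D₁ f₁ i) α)).2
  have hwK : ∀ (i : Fin (k + 1)) (β : Fin (finrank K (Kr K D₂ f₂ (k - i)))), w i (Sum.inl β) * f₂ = 0 :=
    fun i β => (mem_Kr.mp (vecs_mem K (Kr K D₂ f₂ (k - i)) β)).2
  -- `θ ∧ f₁f₂ = 0`, rewritten as a vanishing combination of the image products
  have key : ∑ y : (Σ i : Fin (k + 1), Fin (finrank K (C₁ i)) × Fin (finrank K (C₂ (k - i)))),
      (c ⟨y.1, (Sum.inr y.2.1, Sum.inr y.2.2)⟩ * (-1 : K) ^ ((k - (y.1 : ℕ)) * d₁)) • (v' y.1 y.2.1 * w' y.1 y.2.2) = 0 := by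
    have h0 : (∑ x, c x • P x) * (f₁ * f₂) = 0 := by rw [hc]; exact hθf
    rw [Finset.sum_mul] at h0
    have h1 : ∀ x, (c x • P x) * (f₁ * f₂) =
        (c x * (-1 : K) ^ ((k - (x.1 : ℕ)) * d₁)) • ((v x.1 x.2.1 * f₁) * (w x.1 x.2.2 * f₂)) := fun x => by
      rw [smul_mul_assoc, mul_mul_mul_eq K hf₁ (hw x.1 x.2.2), smul_smul]
    simp_rw [h1] at h0
    rw [Fintype.sum_sigma] at h0 ⊢
    rw [← h0]
    refine Finset.sum_congr rfl fun i _ => ?_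
    rw [Fintype.sum_prod_type, Fintype.sum_prod_type, Fintype.sum_sum_type]
    have hl : ∑ α : Fin (finrank K (Kr K D₁ f₁ i)), ∑ β, (c ⟨i, (Sum.inl α, β)⟩ * (-1 : K) ^ ((k - (i : ℕ)) * d₁)) •
        ((v i (Sum.inl α) * f₁) * (w i β * f₂)) = 0 :=
      Finset.sum_eq_zero fun α _ => Finset.sum_eq_zero fun β _ => by rw [hvK, zero_mul, smul_zero]
    rw [hl, zero_add]
    refine Finset.sum_congr rfl fun α _ => ?_
    rw [Fintype.sum_sum_type]
    have hl' : ∑ β : Fin (finrank K (Kr K D₂ f₂ (k - i))), (c ⟨i, (Sum.inr α, Sum.inl β)⟩ * (-1 : K) ^ ((k - (i : ℕ)) * d₁)) •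
        ((v i (Sum.inr α) * f₁) * (w i (Sum.inl β) * f₂)) = 0 :=
      Finset.sum_eq_zero fun β _ => by rw [hwK, mul_zero, smul_zero]
    rw [hl', zero_add]
    rfl
  have hcoef : ∀ y : (Σ i : Fin (k + 1), Fin (finrank K (C₁ i)) × Fin (finrank K (C₂ (k - i)))),
      c ⟨y.1, (Sum.inr y.2.1, Sum.inr y.2.2)⟩ = 0 := fun y => by
    have h := Fintype.linearIndependent_iff.mp hQli _ key y
    exact (mul_eq_zero.mp h).resolve_right (pow_ne_zero _ (neg_ne_zero.mpr one_ne_zero))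
  -- what is left lies in the Künneth kernel sum
  rw [← hc]
  refine Submodule.sum_mem _ fun x _ => ?_
  obtain ⟨i, α, β⟩ := x
  have hik : (i : ℕ) ∈ Finset.range (k + 1) := Finset.mem_range.mpr i.2
  rcases α with α | α
  · exact Submodule.smul_mem _ _ (Submodule.mem_iSup_of_mem (i : ℕ) (Submodule.mem_iSup_of_mem hik
      (Submodule.mem_sup_left (Submodule.mul_mem_mul (vecs_mem K (Kr K D₁ f₁ i) α) (hw i β)))))
  rcases β with β | β
  · exact Submodule.smul_mem _ _ (Submodule.mem_iSup_of_mem (i : ℕ) (Submodule.mem_iSup_of_mem hik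
      (Submodule.mem_sup_right (Submodule.mul_mem_mul (hC₁le i (vecs_mem K (C₁ i) α)) (vecs_mem K (Kr K D₂ f₂ (k - i)) β)))))
  · have h0 := hcoef ⟨i, (α, β)⟩
    simp only at h0
    show c ⟨i, (Sum.inr α, Sum.inr β)⟩ • P ⟨i, (Sum.inr α, Sum.inr β)⟩ ∈ _
    rw [h0, zero_smul]
    exact Submodule.zero_mem _

/-- **THE KÜNNETH KERNEL LAW: `Kr(D₁ ⊔ D₂, f₁f₂, k) = Σ_{a ≤ k} ( Kr(D₁,f₁,a) ∧ Hom(D₂,k−a) + Hom(D₁,a) ∧ Kr(D₂,f₂,k−a) )`** —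
every field, every disjoint blocks, every homogeneous `f₁, f₂`, every degree: THE KERNEL OF A PRODUCT IS GENERATED BY THE
KERNELS OF ITS FACTORS. -/
theorem Kr_union_eq_krSum {D₁ D₂ : Finset I} (hD : Disjoint D₁ D₂) {d₁ d₂ : ℕ} {f₁ f₂ : HT K I}
    (hf₁ : f₁ ∈ Hom K I D₁ d₁) (hf₂ : f₂ ∈ Hom K I D₂ d₂) (k : ℕ) :
    Kr K (D₁ ∪ D₂) (f₁ * f₂) k = krSum K D₁ D₂ f₁ f₂ k :=
  le_antisymm (Kr_union_le_krSum K hD hf₁ hf₂ k) (krSum_le_Kr K hD hf₁ f₂ k)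

/-- `Hom(univ, k) = ⋀^k` (any generator type; cf. `Hankel.exteriorPower_eq_Hom_univ` on `Fin (n+n)`). -/
lemma Hom_univ_eq_exteriorPower (k : ℕ) :
    Hom K I Finset.univ k = (⋀[K]^k (I → K) : Submodule K (HT K I)) := by
  rw [exteriorPower_eq_span, Hom]
  congr 1
  ext x
  simp

/-- the kernel of `θ ↦ θ ∧ F ∣ ⋀^k` is `Kr(univ, F, k)` seen inside `⋀^k`. -/
lemma ker_wedge_eq_comap_Kr (F : HT K I) (k : ℕ) :
    LinearMap.ker (wedge K I k F) = (Kr K Finset.univ F k).comap (⋀[K]^k (I → K)).subtype := by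
  ext θ
  rw [LinearMap.mem_ker, Submodule.mem_comap, Submodule.subtype_apply, mem_Kr, Hom_univ_eq_exteriorPower, wedge,
    LinearMap.comp_apply, Submodule.subtype_apply, LinearMap.mulRight_apply]
  exact ⟨fun h => ⟨θ.2, h⟩, fun h => h.2⟩

/-- **THE KÜNNETH KERNEL LAW, wedge form: `ker(θ ↦ θ ∧ f₁f₂ ∣ ⋀^k) = krSum_k(f₁, f₂)`** when the two blocks cover the generators. -/
theorem ker_wedge_mul {D₁ D₂ : Finset I} (hD : Disjoint D₁ D₂) (hcov : D₁ ∪ D₂ = Finset.univ) {d₁ d₂ : ℕ} {f₁ f₂ : HT K I}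
    (hf₁ : f₁ ∈ Hom K I D₁ d₁) (hf₂ : f₂ ∈ Hom K I D₂ d₂) (k : ℕ) :
    LinearMap.ker (wedge K I k (f₁ * f₂)) = (krSum K D₁ D₂ f₁ f₂ k).comap (⋀[K]^k (I → K)).subtype := by
  rw [ker_wedge_eq_comap_Kr, ← hcov, Kr_union_eq_krSum K hD hf₁ hf₂ k]

end Summit.Ventures.HSemireg.Wedge.KunnethKernel
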